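import Literature.RepresentationTheory.HeisenbergGroup.SchrodingerFibreIrreducibility
import HarnessLib

/-!
# Tube cut-offs by finitely many modulations, and the propagation of fibre-vanishing under a modulation-covariant operator

Topic `RepresentationTheory/HeisenbergGroup`; namespace `Literature.RepresentationTheory.HeisenbergGroup`.  KERNEL ONLY:
theorems, no definition, no named fact, no `sorry`.  Companion of `SchrodingerFibreIrreducibility.lean` (it supplies the
hypothesis (Circ) of `eq_bot_or_eq_of_fibreCriterion` from the action of a compact centre).

`F` a non-archimedean local field, `ψ` continuous non-trivial of conductor `𝔭^m`, `ρ` the smooth Schrödinger model on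
`𝒮(F^{ι₁ ⊔ ι₀})`.

* §1 a character sum over a finite quotient of lattices (`sum_addChar_out_eq`), and the FINITE FOURIER EXPANSION OF A BOX:
  on any bounded set `(𝔭^{-M})^{ι}` the indicator of `(𝔭^N)^ι` is `|Λ/Λ'|⁻¹ Σ_{y ∈ Λ/Λ'} ψ(⟨x, y⟩)`, `Λ = (𝔭^{m-N})^ι ⊇ Λ' =
  (𝔭^{m+M})^ι` (`exists_sum_addChar_eq_indicator`) — [WeilBNT1967, Ch. VII §2, formula (2) and Cor. 1] made finite;
* §2 **`fibre_eq_zero_of_covariant`**: let `M` be a linear operator on `𝒮(F^{ι₁ ⊔ ι₀})` which conjugates the modulations in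
  the `ι₁`-variables along a linear map `r`, `M ρ(0,(y₁,0),0) = ρ(0,(r y₁,0),0) M`, with a dual automorphism `r''` of
  `F^{ι₁}` (`⟨r'' s, r t⟩ = ⟨s, t⟩`), and let `f` be an EIGENVECTOR of `M` with non-zero eigenvalue.  If `f` vanishes on the
  fibre over `θ` then it vanishes on the fibre over `r'' θ`: the tube cut-off of `f` around `θ` is a finite combination of
  modulated copies of `f`, it is `0`, apply `M`.

In the cell `hodgecm-mathlib` (fan B, rung B-IV) `M` is the action of an element of the compact member `U(1) = E_v¹` of the
dual pair in a Schrödinger model adapted to an isotropic line (it rotates the modulations along the line), `f` a vector of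
its `χ`-isotypic subspace; transitivity of `E_v¹` on the norm-level sets then gives (Circ).  Nothing about theta lifts is
asserted here.

## References
* [WeilBNT1967] A. Weil, *Basic Number Theory* (1967), Ch. VII §2, formula (2), Cor. 1 (Fourier transform of the
  characteristic function of a lattice).
* [MoeglinVignerasWaldspurger1987] C. Mœglin, M.-F. Vignéras, J.-L. Waldspurger, LNM 1291 (1987), Chap. 3 §IV.2 (the action
  of `U(W)` on the mixed model `𝒮(Hom(X', W)) ⊗ S°`).
-/

set_option autoImplicit false

noncomputable section

namespace Literature.RepresentationTheory.HeisenbergGroup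

open Literature.NumberTheory.Automorphic
open Literature.NumberTheory.GaloisRepresentations.IsNonarchimedeanLocalField
open scoped Pointwise Classical

variable {F : Type*} [Field F] [ValuativeRel F] [TopologicalSpace F] [IsNonarchimedeanLocalField F]

/-! ## §1 Finite Fourier expansion of a box on a bounded set -/

section Fourier

variable {ι : Type*} [Fintype ι]

/-- a character sum over a finite quotient: for `η : C → ℂ` multiplicative on the additive group `C` and trivial on
`C₀ ≤ C`, `Σ_{q ∈ C/C₀} η(q.out)` is `|C/C₀|` if `η` is trivial and `0` otherwise. [cite: WeilBNT1967, Ch. VII §2, Cor. 1] -/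
theorem sum_addChar_out_eq {L : Type*} [AddCommGroup L] (C : AddSubgroup L) (C₀ : AddSubgroup C)
    [Fintype (C ⧸ C₀)] (η : C → ℂ) (hadd : ∀ a b : C, η (a + b) = η a * η b) (hC₀ : ∀ c ∈ C₀, η c = 1) :
    (∑ q : C ⧸ C₀, η q.out) = if ∀ c : C, η c = 1 then (Fintype.card (C ⧸ C₀) : ℂ) else 0 := by
  split_ifs with h
  · simp only [h, Finset.sum_const, Finset.card_univ, nsmul_eq_mul, mul_one]
  · obtain ⟨c₁, hc₁⟩ := not_forall.1 h
    have hcoset : ∀ a : C, η ((QuotientAddGroup.mk a : C ⧸ C₀).out) = η a := by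
      intro a
      obtain ⟨h₀, hh₀⟩ := QuotientAddGroup.mk_out_eq_mul C₀ a
      rw [hh₀, hadd, hC₀ h₀ h₀.2, mul_one]
    have hre : ∀ q : C ⧸ C₀, η (c₁ +ᵥ q).out = η c₁ * η q.out := by
      intro q
      have hq : (c₁ +ᵥ q : C ⧸ C₀) = QuotientAddGroup.mk (c₁ + q.out) := by
        rw [← AddAction.Quotient.coe_vadd_out, vadd_eq_add]
      rw [hq, hcoset, hadd]
    have hsum : (∑ q : C ⧸ C₀, η q.out) = η c₁ * ∑ q : C ⧸ C₀, η q.out := by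
      rw [Finset.mul_sum]
      simp_rw [← hre]
      exact (Fintype.sum_equiv (AddAction.toPerm c₁) _ _ fun q => rfl).symm
    have h1 : (1 - η c₁) * ∑ q : C ⧸ C₀, η q.out = 0 := by rw [sub_mul, one_mul, ← hsum, sub_self]
    rcases mul_eq_zero.1 h1 with h2 | h2
    · exact absurd (sub_eq_zero.1 h2).symm hc₁
    · exact h2

/-- `ψ(⟨x, ·⟩)` is trivial on `(𝔭^{m-N})^ι` exactly when `x ∈ (𝔭^N)^ι` (`𝔭^m` the conductor).
[cite: WeilBNT1967, Ch. VII §2, Cor. 1] -/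
theorem forall_addChar_dotProduct_eq_one_iff {ψ : AddChar F Circle} {m : ℤ} (hm : ψ.HasConductorExp m) (N : ℤ)
    (x : ι → F) : (∀ y ∈ piPrimePowBall F ι (m - N), ψ (x ⬝ᵥ y) = 1) ↔ x ∈ piPrimePowBall F ι N := by
  constructor
  · intro h
    by_contra hx
    rw [mem_piPrimePowBall_iff] at hx
    push Not at hx
    obtain ⟨i, hi⟩ := hx
    have hi' : x i ∉ primePowBall F (m - (m - N)) := by rwa [sub_sub_cancel]
    obtain ⟨y₀, hy₀, hne⟩ := exists_mem_primePowBall_addChar_mul_ne_one hm hi'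
    apply hne
    have := h (Pi.single i y₀) (single_mem_piPrimePowBall i hy₀)
    rwa [dotProduct_single, mul_comm] at this
  · intro hx y hy
    refine hm.1 _ ?_
    have := dotProduct_mem_primePowBall hx hy
    rwa [add_sub_cancel] at this

/-- **finite Fourier expansion of a box on a bounded set**: for every `N` and every bound `M₀` there are finitely many
`y_i ∈ F^ι` and a constant `c` with `Σ_i c ψ(⟨x, y_i⟩) = 1_{(𝔭^N)^ι}(x)` for all `x ∈ (𝔭^{-M₀})^ι` (the `y_i` run over
`(𝔭^{m-N})^ι` modulo a small box, `c = ` the inverse of their number). [cite: WeilBNT1967, Ch. VII §2, formula (2)] -/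
theorem exists_sum_addChar_eq_indicator {ψ : AddChar F Circle} (hψ : ψ.IsContinuousNontrivial) (N M₀ : ℤ) :
    ∃ (k : ℕ) (y : Fin k → ι → F) (c : ℂ), ∀ x ∈ piPrimePowBall F ι (-M₀),
      ∑ i, c * (ψ (x ⬝ᵥ y i) : ℂ) = if x ∈ piPrimePowBall F ι N then 1 else 0 := by
  obtain ⟨m, hm⟩ := hψ.exists_hasConductorExp
  -- the lattices `Λ = (𝔭^{m-N})^ι ⊇ Λ' = (𝔭^{max (m-N) (m+M₀)})^ι`
  let box : ℤ → AddSubgroup (ι → F) := fun n =>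
    { carrier := piPrimePowBall F ι n
      add_mem' := fun ha hb => add_mem_piPrimePowBall ha hb
      zero_mem' := zero_mem_piPrimePowBall n
      neg_mem' := fun ha => neg_mem_piPrimePowBall ha }
  set n' : ℤ := max (m - N) (m + M₀) with hn'
  let C : AddSubgroup (ι → F) := box (m - N)
  let C₀ : AddSubgroup C := (box n').addSubgroupOf C
  haveI : Finite (C ⧸ C₀) := by
    haveI : CompactSpace C := isCompact_iff_compactSpace.1 (isCompact_piPrimePowBall (m - N))
    exact AddSubgroup.quotient_finite_of_isOpen _ ((isOpen_piPrimePowBall n').preimage continuous_subtype_val)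
  letI : Fintype (C ⧸ C₀) := Fintype.ofFinite _
  have hcard : (Fintype.card (C ⧸ C₀) : ℂ) ≠ 0 := Nat.cast_ne_zero.2 Fintype.card_ne_zero
  let e := Fintype.equivFin (C ⧸ C₀)
  refine ⟨Fintype.card (C ⧸ C₀), fun i => ((e.symm i).out : C), (Fintype.card (C ⧸ C₀) : ℂ)⁻¹, fun x hx => ?_⟩
  rw [← Finset.mul_sum, e.symm.sum_comp (fun q : C ⧸ C₀ => ((ψ (x ⬝ᵥ ((q.out : C) : ι → F)) : Circle) : ℂ))]
  -- the character `η(λ) = ψ(⟨x, λ⟩)` of `C`, trivial on `C₀`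
  have hsum := sum_addChar_out_eq C C₀ (fun lam : C => (ψ (x ⬝ᵥ (lam : ι → F)) : ℂ))
    (fun a b => by rw [AddSubgroup.coe_add, dotProduct_add, AddChar.map_add_eq_mul, Circle.coe_mul])
    (fun lam hlam => by
      have hlam' : (lam : ι → F) ∈ piPrimePowBall F ι n' := hlam
      have h1 : x ⬝ᵥ (lam : ι → F) ∈ primePowBall F m := by
        have := dotProduct_mem_primePowBall hx (piPrimePowBall_antitone (le_max_right _ _) hlam')
        rwa [show -M₀ + (m + M₀) = m by ring] at this
      rw [hm.1 _ h1, Circle.coe_one])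
  rw [hsum]
  have hiff : (∀ lam : C, ((ψ (x ⬝ᵥ (lam : ι → F)) : Circle) : ℂ) = 1) ↔ x ∈ piPrimePowBall F ι N := by
    rw [← forall_addChar_dotProduct_eq_one_iff hm N x]
    constructor
    · intro h y hy
      have := h ⟨y, hy⟩
      exact Circle.coe_inj.1 (by rw [Circle.coe_one]; exact this)
    · intro h lam
      rw [h lam lam.2, Circle.coe_one]
  by_cases hxN : x ∈ piPrimePowBall F ι N
  · rw [if_pos (hiff.2 hxN), if_pos hxN, inv_mul_cancel₀ hcard]
  · rw [if_neg (fun h => hxN (hiff.1 h)), if_neg hxN, mul_zero]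

/-- a compact subset of `F^ι` lies in some box `(𝔭^{-M})^ι`. [cite: WeilBNT1967, Ch. II §1, Prop. 1] -/
theorem exists_subset_piPrimePowBall_of_isCompact {K : Set (ι → F)} (hK : IsCompact K) :
    ∃ M : ℤ, K ⊆ piPrimePowBall F ι (-M) := by
  have hcover : K ⊆ ⋃ k : ℕ, piPrimePowBall F ι (-(k : ℤ)) := fun x _ =>
    let ⟨k, hk⟩ := exists_mem_piPrimePowBall x
    Set.mem_iUnion.2 ⟨k, hk⟩
  have hdir : Directed (· ⊆ ·) fun k : ℕ => piPrimePowBall F ι (-(k : ℤ)) :=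
    Monotone.directed_le fun a b hab => piPrimePowBall_antitone (by omega)
  obtain ⟨k, hk⟩ := hK.elim_directed_cover _ (fun k => isOpen_piPrimePowBall _) hcover hdir
  exact ⟨k, hk⟩

end Fourier

/-! ## §2 Propagation of fibre-vanishing under a modulation-covariant operator -/

section Covariant

variable {ι₁ ι₀ : Type*} [Fintype ι₁] [Fintype ι₀]
  {ψ : AddChar F Circle} (hl : IsLocallyConstant (⇑ψ : F → Circle))
  (hb : ∀ y : ι₁ ⊕ ι₀ → F, Continuous fun u : ι₁ ⊕ ι₀ → F => dotProductBilin F F u y)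

/-- **propagation of fibre-vanishing.**  Let `M` be a linear operator on `𝒮(F^{ι₁ ⊔ ι₀})` with
`M ρ(0, (y₁, 0), 0) = ρ(0, (r y₁, 0), 0) M` for all `y₁` (`r` linear), let `r''` be a linear automorphism of `F^{ι₁}` with
`⟨r'' s, r t⟩ = ⟨s, t⟩`, and let `M f = c f` with `c ≠ 0`.  If `f` vanishes on the fibre over `θ`, it vanishes on the fibre
over `r'' θ`. [cite: MoeglinVignerasWaldspurger1987, Chap. 3 §IV.2] -/
theorem fibre_eq_zero_of_covariant (hψ : ψ.IsContinuousNontrivial)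
    (M : SchwartzBruhat (ι₁ ⊕ ι₀ → F) →ₗ[ℂ] SchwartzBruhat (ι₁ ⊕ ι₀ → F))
    (r : (ι₁ → F) →ₗ[F] (ι₁ → F)) (r'' : (ι₁ → F) ≃ₗ[F] (ι₁ → F))
    (hcov : ∀ (y₁ : ι₁ → F) (f : SchwartzBruhat (ι₁ ⊕ ι₀ → F)),
      M (schrodingerSB (dotProductBilin F F) ψ hl hb (piModul (Sum.elim y₁ 0)) f) =
        schrodingerSB (dotProductBilin F F) ψ hl hb (piModul (Sum.elim (r y₁) 0)) (M f))
    (hdual : ∀ s t : ι₁ → F, r'' s ⬝ᵥ r t = s ⬝ᵥ t)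
    {f : SchwartzBruhat (ι₁ ⊕ ι₀ → F)} {c : ℂ} (hc : c ≠ 0) (hf : M f = c • f)
    {θ : ι₁ → F} (hθ : ∀ u₀ : ι₀ → F, (f : (ι₁ ⊕ ι₀ → F) → ℂ) (Sum.elim θ u₀) = 0) :
    ∀ u₀ : ι₀ → F, (f : (ι₁ ⊕ ι₀ → F) → ℂ) (Sum.elim (r'' θ) u₀) = 0 := by
  classical
  haveI : T2Space F := (isLocalField F).toT2Space
  -- the tube around `θ` on which `f` vanishes
  obtain ⟨N, hN⟩ := exists_forall_eq_zero_of_fibre_eq_zero f.2 θ hθ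
  -- a common bound for `u₁ - θ` and `r''⁻¹ u₁ - θ` on the support
  have hfmem : (f : (ι₁ ⊕ ι₀ → F) → ℂ) ∈ SchwartzBruhat (ι₁ ⊕ ι₀ → F) := f.2
  rw [mem_schwartzBruhat_iff] at hfmem
  have hπ : Continuous fun u : ι₁ ⊕ ι₀ → F => (u ∘ Sum.inl : ι₁ → F) :=
    continuous_pi fun i => continuous_apply (Sum.inl i)
  have hr''c : Continuous (r''.symm : (ι₁ → F) → (ι₁ → F)) := (r''.symm : (ι₁ → F) →ₗ[F] (ι₁ → F)).continuous_on_pi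
  obtain ⟨M₁, hM₁⟩ := exists_subset_piPrimePowBall_of_isCompact
    ((hfmem.2.isCompact.image hπ).image (continuous_id.sub continuous_const : Continuous fun s : ι₁ → F => s - θ))
  obtain ⟨M₂, hM₂⟩ := exists_subset_piPrimePowBall_of_isCompact
    ((hfmem.2.isCompact.image hπ).image
      ((hr''c.sub continuous_const) : Continuous fun s : ι₁ → F => r''.symm s - θ))
  set M₀ := max M₁ M₂ with hM₀
  have hb1 : ∀ u ∈ tsupport (f : (ι₁ ⊕ ι₀ → F) → ℂ), u ∘ Sum.inl - θ ∈ piPrimePowBall F ι₁ (-M₀) := fun u hu =>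
    piPrimePowBall_antitone (by rw [hM₀]; omega) (hM₁ ⟨u ∘ Sum.inl, ⟨u, hu, rfl⟩, rfl⟩)
  have hb2 : ∀ u ∈ tsupport (f : (ι₁ ⊕ ι₀ → F) → ℂ), r''.symm (u ∘ Sum.inl) - θ ∈ piPrimePowBall F ι₁ (-M₀) :=
    fun u hu => piPrimePowBall_antitone (by rw [hM₀]; omega) (hM₂ ⟨u ∘ Sum.inl, ⟨u, hu, rfl⟩, rfl⟩)
  -- the finite Fourier expansion of the box `(𝔭^N)^{ι₁}` on `(𝔭^{-M₀})^{ι₁}`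
  obtain ⟨k, yv, cK, hK⟩ := exists_sum_addChar_eq_indicator (ι := ι₁) hψ N M₀
  -- the tube cut-off of `f` as a combination of modulated copies: it vanishes
  have hzero : ∑ i : Fin k, (cK * (ψ (-(θ ⬝ᵥ yv i)) : ℂ)) •
      schrodingerSB (dotProductBilin F F) ψ hl hb (piModul (Sum.elim (yv i) 0)) f = 0 := by
    apply Subtype.ext
    rw [AddSubmonoidClass.coe_finsetSum, ZeroMemClass.coe_zero]
    funext u
    rw [Finset.sum_apply, Pi.zero_apply]
    have hcalc : ∀ i : Fin k, (((cK * (ψ (-(θ ⬝ᵥ yv i)) : ℂ)) •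
        schrodingerSB (dotProductBilin F F) ψ hl hb (piModul (Sum.elim (yv i) 0)) f : SchwartzBruhat (ι₁ ⊕ ι₀ → F)) :
          (ι₁ ⊕ ι₀ → F) → ℂ) u = cK * (ψ ((u ∘ Sum.inl - θ) ⬝ᵥ yv i) : ℂ) * (f : (ι₁ ⊕ ι₀ → F) → ℂ) u := by
      intro i
      rw [Submodule.coe_smul, Pi.smul_apply, smul_eq_mul, schrodingerSB_piModul_apply,
        ← Sum.elim_comp_inl_inr u, sumElim_dotProduct_sumElim, dotProduct_zero, add_zero, Sum.elim_comp_inl_inr,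
        sub_dotProduct, AddChar.map_sub_eq_div, Circle.coe_div, AddChar.map_neg_eq_inv, Circle.coe_inv]
      ring
    rw [Finset.sum_congr rfl fun i _ => hcalc i]
    by_cases hu : u ∈ tsupport (f : (ι₁ ⊕ ι₀ → F) → ℂ)
    · rw [← Finset.sum_mul, hK _ (hb1 u hu)]
      split_ifs with h1
      · rw [hN u h1, mul_zero]
      · rw [zero_mul]
    · rw [image_eq_zero_of_notMem_tsupport hu]
      simp only [mul_zero, Finset.sum_const_zero]
  -- apply `M`: the combination with `r y` of `c • f` vanishes
  have hM0 := congr_arg M hzero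
  rw [map_zero, map_sum] at hM0
  simp_rw [map_smul, hcov, hf, map_smul] at hM0
  -- evaluate at `u = (r'' θ, u₀)`
  intro u₀
  by_contra hne
  have h := congr_arg (fun w : SchwartzBruhat (ι₁ ⊕ ι₀ → F) => (w : (ι₁ ⊕ ι₀ → F) → ℂ) (Sum.elim (r'' θ) u₀)) hM0
  simp only [AddSubmonoidClass.coe_finsetSum, Finset.sum_apply, Submodule.coe_smul, Pi.smul_apply, smul_eq_mul,
    schrodingerSB_piModul_apply, sumElim_dotProduct_sumElim, dotProduct_zero, add_zero, ZeroMemClass.coe_zero,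
    Pi.zero_apply, hdual] at h
  have hcalc : ∑ i : Fin k, cK * (ψ (-(θ ⬝ᵥ yv i)) : ℂ) *
      (c * ((ψ (θ ⬝ᵥ yv i) : ℂ) * (f : (ι₁ ⊕ ι₀ → F) → ℂ) (Sum.elim (r'' θ) u₀)))
      = c * (∑ i : Fin k, cK * (ψ ((0 : ι₁ → F) ⬝ᵥ yv i) : ℂ)) * (f : (ι₁ ⊕ ι₀ → F) → ℂ) (Sum.elim (r'' θ) u₀) := by
    rw [Finset.mul_sum, Finset.sum_mul]
    refine Finset.sum_congr rfl fun i _ => ?_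
    rw [zero_dotProduct, AddChar.map_zero_eq_one, Circle.coe_one, mul_one, AddChar.map_neg_eq_inv, Circle.coe_inv]
    have hψ0 : ((ψ (θ ⬝ᵥ yv i) : Circle) : ℂ) ≠ 0 := Circle.coe_ne_zero _
    field_simp
  rw [hcalc, hK 0 (zero_mem_piPrimePowBall _), if_pos (zero_mem_piPrimePowBall _), mul_one] at h
  exact (mul_ne_zero hc hne) h

end Covariant

end Literature.RepresentationTheory.HeisenbergGroup

end
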